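import Mathlib
import Summits.Ventures.PercRepro2.Defs
import Summits.Ventures.PercRepro2.Independence
import Summits.Ventures.PercRepro2.Harris
import Summits.Ventures.PercRepro2.CoinDefs
import Summits.Ventures.PercRepro2.CoinArcsOff
import Summits.Ventures.PercRepro2.CoinPendantDefs
import Summits.Ventures.PercRepro2.CoinPendant
import Summits.Ventures.PercRepro2.CoinInduced
import Summits.Ventures.PercRepro2.CoinVdBK
import Summits.Ventures.PercRepro2.CoinBHK
import Summits.Ventures.PercRepro2.CoinReverse
import Summits.Ventures.PercRepro2.CoinLemmaA
import Summits.Ventures.PercRepro2.CoinDarcMixed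
import Summits.Ventures.PercRepro2.CoinTwoPendantDefs
import Summits.Ventures.PercRepro2.CoinTwoPendantMass
import Summits.Ventures.PercRepro2.CoinTraceLevels
import Summits.Ventures.PercRepro2.CoinTraceTower
import Summits.Ventures.PercRepro2.CoinTraceReduce
import Summits.Ventures.PercRepro2.CoinTraceFn
import Summits.Ventures.PercRepro2.CoinTraceBlock
import Summits.Ventures.PercRepro2.CoinTraceShift
import Summits.Ventures.PercRepro2.CoinTwoStar
import Summits.Ventures.PercRepro2.CoinPivotalPair
import Summits.Ventures.PercRepro2.CoinPivotalPairForce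

/-!
# The literal DIAMOND and SIDE-BRANCH heads (blind cell PercRepro2, night-2 g3;
proofs/NIGHT2-DARC.md §17.7)

Explicit four-coin instances of `darc_of_forcing_head`: the DIAMOND `w → v₁, v₁ → v₂, w → v₂,
v₂ → t` (the head forces `v₂`; `Z₁ = {w, v₂}`, free vertex `v₁`) and the SIDE-BRANCH
`w → v₁, v₁ → t, v₁ → v₂, v₂ → t` (the head forces `v₁`; `Z₁ = {w, v₁}`, free vertex `v₂`), with
the four coins the only coins carrying arcs with tails in `{w, v₁, v₂}` (entries arbitrary).
-/

namespace Summit.Ventures.PercRepro2.Coin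

section Aux

variable {V : Type*} {E : Type*}

/-- The only coins with a tail in `{w, v₁, v₂}` are the four listed single arcs. -/
def OnlyFourCoins (arcs : E → Finset (V × V)) (w v₁ v₂ : V) (e₁ e₂ e₃ e₄ : E)
    (a₁ a₂ a₃ a₄ : V × V) : Prop :=
  arcs e₁ = {a₁} ∧ arcs e₂ = {a₂} ∧ arcs e₃ = {a₃} ∧ arcs e₄ = {a₄} ∧
    ∀ e, (∃ xy ∈ arcs e, xy.1 = w ∨ xy.1 = v₁ ∨ xy.1 = v₂) → e = e₁ ∨ e = e₂ ∨ e = e₃ ∨ e = e₄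

/-- Under `OnlyFourCoins`, an arc with tail in the head set is one of the four arcs. -/
lemma arc_of_onlyFourCoins {arcs : E → Finset (V × V)} {w v₁ v₂ : V} {e₁ e₂ e₃ e₄ : E}
    {a₁ a₂ a₃ a₄ : V × V} (h : OnlyFourCoins arcs w v₁ v₂ e₁ e₂ e₃ e₄ a₁ a₂ a₃ a₄) {e : E}
    {xy : V × V} (hxy : xy ∈ arcs e) (hx : xy.1 = w ∨ xy.1 = v₁ ∨ xy.1 = v₂) :
    (e = e₁ ∧ xy = a₁) ∨ (e = e₂ ∧ xy = a₂) ∨ (e = e₃ ∧ xy = a₃) ∨ (e = e₄ ∧ xy = a₄) := by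
  obtain ⟨h₁, h₂, h₃, h₄, honly⟩ := h
  rcases honly e ⟨xy, hxy, hx⟩ with rfl | rfl | rfl | rfl
  · rw [h₁, Finset.mem_singleton] at hxy; exact Or.inl ⟨rfl, hxy⟩
  · rw [h₂, Finset.mem_singleton] at hxy; exact Or.inr (Or.inl ⟨rfl, hxy⟩)
  · rw [h₃, Finset.mem_singleton] at hxy; exact Or.inr (Or.inr (Or.inl ⟨rfl, hxy⟩))
  · rw [h₄, Finset.mem_singleton] at hxy; exact Or.inr (Or.inr (Or.inr ⟨rfl, hxy⟩))

/-- The first step of a path from `x ≠ y`. -/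
lemma reach_first_step {arcs : E → Finset (V × V)} {ω : Config E} {x y : V} (h : Reach arcs ω x y)
    (hne : x ≠ y) : ∃ z, OpenArc arcs ω x z ∧ Reach arcs ω z y := by
  rcases Relation.ReflTransGen.cases_head h with heq | ⟨z, hxz, hzy⟩
  · exact absurd heq hne
  · exact ⟨z, hxz, hzy⟩

end Aux

section Diamond

open Classical

variable {V : Type*} {E : Type*} [Fintype V] [DecidableEq V] [Fintype E] [DecidableEq E]
  {R : Type*} [Field R] [LinearOrder R] [IsStrictOrderedRing R]

omit [Fintype V] [DecidableEq V] [Fintype E] [DecidableEq E] in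
/-- In the diamond, `w ∈ K⁻` forces `v₂ ∈ K⁻`. -/
lemma diamond_forces {arcs : E → Finset (V × V)} {w v₁ v₂ t : V} {e₁ e₂ e₃ e₄ : E}
    (h : OnlyFourCoins arcs w v₁ v₂ e₁ e₂ e₃ e₄ (w, v₁) (v₁, v₂) (w, v₂) (v₂, t))
    (hwv₁ : w ≠ v₁) (hwv₂ : w ≠ v₂) (hv₁₂ : v₁ ≠ v₂) (hwt : w ≠ t) (hv₁t : v₁ ≠ t)
    (ω : Config E) (hw : ω ∈ bwdEvent arcs w {t}) : ω ∈ bwdEvent arcs v₂ {t} := by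
  simp only [bwdEvent, Set.mem_setOf_eq, Finset.mem_singleton, exists_eq_left] at hw ⊢
  obtain ⟨z, ⟨e, _, hxz⟩, hzt⟩ := reach_first_step hw hwt
  rcases arc_of_onlyFourCoins h hxz (Or.inl rfl) with ⟨_, hz⟩ | ⟨_, hz⟩ | ⟨_, hz⟩ | ⟨_, hz⟩ <;>
    rw [Prod.mk.injEq] at hz
  · -- `z = v₁`: the next step is `v₁ → v₂`
    rw [hz.2] at hzt
    obtain ⟨z', ⟨e', _, hxz'⟩, hz't⟩ := reach_first_step hzt hv₁t
    rcases arc_of_onlyFourCoins h hxz' (Or.inr (Or.inl rfl)) with ⟨_, hz'⟩ | ⟨_, hz'⟩ |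
      ⟨_, hz'⟩ | ⟨_, hz'⟩ <;> rw [Prod.mk.injEq] at hz'
    · exact absurd hz'.1.symm hwv₁
    · rw [hz'.2] at hz't; exact hz't
    · exact absurd hz'.1.symm hwv₁
    · exact absurd hz'.1 hv₁₂
  · exact absurd hz.1 hwv₁
  · rw [hz.2] at hzt; exact hzt
  · exact absurd hz.1 hwv₂

omit [Fintype V] [DecidableEq V] [Fintype E] [DecidableEq E] in
/-- In the side-branch, `w ∈ K⁻` forces `v₁ ∈ K⁻`. -/
lemma sideBranch_forces {arcs : E → Finset (V × V)} {w v₁ v₂ t : V} {e₁ e₂ e₃ e₄ : E}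
    (h : OnlyFourCoins arcs w v₁ v₂ e₁ e₂ e₃ e₄ (w, v₁) (v₁, t) (v₁, v₂) (v₂, t))
    (hwv₁ : w ≠ v₁) (hwv₂ : w ≠ v₂) (hwt : w ≠ t) (ω : Config E)
    (hw : ω ∈ bwdEvent arcs w {t}) : ω ∈ bwdEvent arcs v₁ {t} := by
  simp only [bwdEvent, Set.mem_setOf_eq, Finset.mem_singleton, exists_eq_left] at hw ⊢
  obtain ⟨z, ⟨e, _, hxz⟩, hzt⟩ := reach_first_step hw hwt
  rcases arc_of_onlyFourCoins h hxz (Or.inl rfl) with ⟨_, hz⟩ | ⟨_, hz⟩ | ⟨_, hz⟩ | ⟨_, hz⟩ <;>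
    rw [Prod.mk.injEq] at hz
  · rw [hz.2] at hzt; exact hzt
  · exact absurd hz.1 hwv₁
  · exact absurd hz.1 hwv₁
  · exact absurd hz.1 hwv₂

omit [Fintype V] [Fintype E] [DecidableEq E] in
/-- `ClosedOut` from `OnlyFourCoins` when the four heads lie in `P ∪ {t}`. -/
lemma closedOut_of_onlyFourCoins {arcs : E → Finset (V × V)} {w v₁ v₂ t : V} {e₁ e₂ e₃ e₄ : E}
    {a₁ a₂ a₃ a₄ : V × V} (h : OnlyFourCoins arcs w v₁ v₂ e₁ e₂ e₃ e₄ a₁ a₂ a₃ a₄)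
    {P : Finset V} (hPmem : ∀ x, x ∈ P ↔ (x = w ∨ x = v₁ ∨ x = v₂))
    (h₁ : a₁.2 ∈ P ∪ {t}) (h₂ : a₂.2 ∈ P ∪ {t}) (h₃ : a₃.2 ∈ P ∪ {t}) (h₄ : a₄.2 ∈ P ∪ {t}) :
    ClosedOut arcs P {t} := by
  intro e xy hxy hx
  rcases arc_of_onlyFourCoins h hxy ((hPmem _).mp hx) with ⟨_, rfl⟩ | ⟨_, rfl⟩ | ⟨_, rfl⟩ |
    ⟨_, rfl⟩
  · exact h₁
  · exact h₂
  · exact h₃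
  · exact h₄

omit [Fintype V] [Fintype E] [DecidableEq E] in
/-- `TailCoinsIn` from `OnlyFourCoins` when the four tails lie in `P`. -/
lemma tailCoinsIn_of_onlyFourCoins {arcs : E → Finset (V × V)} {w v₁ v₂ t : V}
    {e₁ e₂ e₃ e₄ : E} {a₁ a₂ a₃ a₄ : V × V}
    (h : OnlyFourCoins arcs w v₁ v₂ e₁ e₂ e₃ e₄ a₁ a₂ a₃ a₄)
    {P : Finset V} (hPmem : ∀ x, x ∈ P ↔ (x = w ∨ x = v₁ ∨ x = v₂))
    (h₁ : a₁.1 ∈ P) (h₂ : a₂.1 ∈ P) (h₃ : a₃.1 ∈ P) (h₄ : a₄.1 ∈ P) : TailCoinsIn arcs P {t} := by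
  intro e he xy hxy
  obtain ⟨x'y', hx'y', hx'⟩ := he
  rcases arc_of_onlyFourCoins h hx'y' ((hPmem _).mp hx') with ⟨rfl, _⟩ | ⟨rfl, _⟩ | ⟨rfl, _⟩ |
    ⟨rfl, _⟩
  · rw [h.1, Finset.mem_singleton] at hxy; rw [hxy]; exact Finset.mem_union_left _ h₁
  · rw [h.2.1, Finset.mem_singleton] at hxy; rw [hxy]; exact Finset.mem_union_left _ h₂
  · rw [h.2.2.1, Finset.mem_singleton] at hxy; rw [hxy]; exact Finset.mem_union_left _ h₃
  · rw [h.2.2.2.1, Finset.mem_singleton] at hxy; rw [hxy]; exact Finset.mem_union_left _ h₄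

/-- **THEOREM (the literal DIAMOND `w → v₁, v₁ → v₂, w → v₂, v₂ → t`, row 2′DARC).** -/
theorem darc_of_diamond_coins (p : E → R) (hp : IsProbVec p) {arcs : E → Finset (V × V)}
    (hS : SameEnds arcs) (s a b u w v₁ v₂ t : V) (hwv₁ : w ≠ v₁) (hwv₂ : w ≠ v₂) (hv₁₂ : v₁ ≠ v₂)
    (hwt : w ≠ t) (hv₁t : v₁ ≠ t) {e₁ e₂ e₃ e₄ : E}
    (h : OnlyFourCoins arcs w v₁ v₂ e₁ e₂ e₃ e₄ (w, v₁) (v₁, v₂) (w, v₂) (v₂, t))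
    (ha : a ∉ insert v₁ ({w, v₂} : Finset V) ∪ {t}) (hb : b ∉ insert v₁ ({w, v₂} : Finset V) ∪ {t})
    (hu : u ∉ insert v₁ ({w, v₂} : Finset V) ∪ {t})
    (hP : ∀ Z ∈ (insert v₁ ({w, v₂} : Finset V)).powerset,
      0 < prob p (avoidEvent (arcsOff arcs (insert v₁ ({w, v₂} : Finset V) ∪ {t})) s (Z ∪ {t})))
    (hQ : ∀ Z ∈ (insert v₁ ({w, v₂} : Finset V)).powerset,
      0 < prob p (avoidEvent (arcsOff arcs (insert v₁ ({w, v₂} : Finset V) ∪ {t})) s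
        (gateTarget u w Z {t}))) :
    DARC p arcs s {t} a b u w := by
  have hPmem : ∀ x, x ∈ insert v₁ ({w, v₂} : Finset V) ↔ (x = w ∨ x = v₁ ∨ x = v₂) := by
    intro x; simp only [Finset.mem_insert, Finset.mem_singleton]; tauto
  refine darc_of_forcing_head p hp hS (w := w) (v := v₁) (Z₁ := {w, v₂}) (by simp)
    (by simp [hwv₁.symm, hv₁₂]) (closedOut_of_onlyFourCoins h hPmem (by simp) (by simp) (by simp) (by simp))
    (tailCoinsIn_of_onlyFourCoins h hPmem (by simp) (by simp) (by simp) (by simp)) ?_ s a b u ha hb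
    hu hP hQ
  intro ω hw z hz
  simp only [Finset.mem_insert, Finset.mem_singleton] at hz
  rcases hz with rfl | rfl
  · exact hw
  · exact diamond_forces h hwv₁ hwv₂ hv₁₂ hwt hv₁t ω hw

/-- **THEOREM (the literal SIDE-BRANCH `w → v₁, v₁ → t, v₁ → v₂, v₂ → t`, row 2′DARC).** -/
theorem darc_of_sideBranch_coins (p : E → R) (hp : IsProbVec p) {arcs : E → Finset (V × V)}
    (hS : SameEnds arcs) (s a b u w v₁ v₂ t : V) (hwv₁ : w ≠ v₁) (hwv₂ : w ≠ v₂) (hv₁₂ : v₁ ≠ v₂)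
    (hwt : w ≠ t) {e₁ e₂ e₃ e₄ : E}
    (h : OnlyFourCoins arcs w v₁ v₂ e₁ e₂ e₃ e₄ (w, v₁) (v₁, t) (v₁, v₂) (v₂, t))
    (ha : a ∉ insert v₂ ({w, v₁} : Finset V) ∪ {t}) (hb : b ∉ insert v₂ ({w, v₁} : Finset V) ∪ {t})
    (hu : u ∉ insert v₂ ({w, v₁} : Finset V) ∪ {t})
    (hP : ∀ Z ∈ (insert v₂ ({w, v₁} : Finset V)).powerset,
      0 < prob p (avoidEvent (arcsOff arcs (insert v₂ ({w, v₁} : Finset V) ∪ {t})) s (Z ∪ {t})))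
    (hQ : ∀ Z ∈ (insert v₂ ({w, v₁} : Finset V)).powerset,
      0 < prob p (avoidEvent (arcsOff arcs (insert v₂ ({w, v₁} : Finset V) ∪ {t})) s
        (gateTarget u w Z {t}))) :
    DARC p arcs s {t} a b u w := by
  have hPmem : ∀ x, x ∈ insert v₂ ({w, v₁} : Finset V) ↔ (x = w ∨ x = v₁ ∨ x = v₂) := by
    intro x; simp only [Finset.mem_insert, Finset.mem_singleton]; tauto
  refine darc_of_forcing_head p hp hS (w := w) (v := v₂) (Z₁ := {w, v₁}) (by simp)
    (by simp [hwv₂.symm, hv₁₂.symm])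
    (closedOut_of_onlyFourCoins h hPmem (by simp) (by simp) (by simp) (by simp))
    (tailCoinsIn_of_onlyFourCoins h hPmem (by simp) (by simp) (by simp) (by simp)) ?_ s a b u ha hb
    hu hP hQ
  intro ω hw z hz
  simp only [Finset.mem_insert, Finset.mem_singleton] at hz
  rcases hz with rfl | rfl
  · exact hw
  · exact sideBranch_forces h hwv₁ hwv₂ hwt ω hw

end Diamond

end Summit.Ventures.PercRepro2.Coin
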